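import Summits.HodgeConjecture.HodgeConjecture.Theorems.SecondaryPeriodsLevelOneConiveauThreefoldsCurveCorrespondencesRankTwo
import Summits.HodgeConjecture.HodgeConjecture.Theorems.SecondaryPeriodsLevelOneConiveauThreefoldsCurveCorrespondencesConverse
import Summits.HodgeConjecture.HodgeConjecture.Theorems.SecondaryPeriodsRiemannWeightOne

/-!
# `LevelOneConiveauThreefolds` (route `SecondaryPeriods`, crux stmt-HodgeConjecture-10376):
# STUB 1 of line `registered` LANDED — the crux is now equivalent to STUB 2 outright

Line `registered` (`Cruxes/LevelOneConiveauThreefolds/Lines/birth.lean`), lead c3, 2026-08-17.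
The route's crux #6 `RiemannWeightOne` (stmt-HodgeConjecture-16406: Riemann's theorem on weight-one
Hodge structures, geometric form) was PROVED in the tree (`riemannWeightOne_proof`,
`Theorems/SecondaryPeriodsRiemannWeightOne`). Consequences for this crux, all UNCONDITIONAL:

* `stub_levelOneSpanOfCurve` — the registered STUB 1 of the line (weight-one realisation of a
  rationally spanned level-one sub-Hodge structure `W ⊆ H³(Y(ℂ); ℂ)` of a smooth projective
  threefold by a CURVE: `W = φ(H¹(C(ℂ); ℂ))`, `φ` rational of type `(1,1)`), by the previous leads'
  reduction `levelOneSpanOfCurve_of_riemannWeightOne` (curve sections + semisimplicity) fed with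
  `riemannWeightOne_proof`.
* `levelOneConiveauThreefolds_iff_curveCorrespondenceAlgebraic` — **the crux ⟺ STUB 2** (every
  rational type-`(1,1)` map `H¹(C(ℂ)) → H³(Y(ℂ))`, `C` a smooth projective curve, `Y` a smooth
  projective threefold, is the action of an ALGEBRAIC codimension-2 class on the fourfold `Y ⊗ C`),
  with NO hypothesis: GHC(3,1) for threefolds is exactly the Hodge conjecture for the
  `(3,1)`-Künneth codimension-2 classes on the fourfolds `Y × C`
  (`levelOneConiveauThreefolds_of_curveCorrespondenceAlgebraic` for the direction the line uses).
* `hodgeImpliesConiveauOne_proof` — Grothendieck's observation HC ⟹ GHC(3,1), i.e. the route's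
  support item `HodgeImpliesConiveauOne` (stmt-HodgeConjecture-3541) BY NAME, unconditionally
  (`levelOneConiveauThreefolds_of_hodgeConjecture` in applied form).
* `coniveauOneFailure_iff_exists_not_curveCorrespondenceAlgebraic` — the negative crux
  `ConiveauOneFailure` (stmt-HodgeConjecture-3540) is witnessed exactly by ONE non-algebraic
  level-one curve correspondence `H¹(C) → H³(Y)`.

## References

* [GrothendieckTopology1969] A. Grothendieck, Hodge's general conjecture is false for trivial
  reasons, Topology 8 (1969) 299–303, p. 301.
* [KerrPearlstein2016] M. Kerr, G. Pearlstein (eds.), Recent Advances in Hodge Theory (CUP 2016),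
  Ch. 11 (S. Abdulali) §1 p. 288 and Prop. 3.2 p. 291.
* [VoisinHodgeI2002] C. Voisin, Hodge Theory and Complex Algebraic Geometry I (CUP 2002), §7.2.2,
  §7.3.1 Lemma 7.26, Lemma 11.41.
-/

noncomputable section

-- `Summit.HodgeConjecture.HodgeConjecture.Theorems` is the mandated namespace (single-conjunct summit:
-- Sub = Summit), which `linter.dupNamespace` flags on every declaration; the lakefile turns the
-- linter off tree-wide (weak option), restated here so stand-alone elaboration is warning-free too.
set_option linter.dupNamespace false

open CategoryTheory AlgebraicGeometry MonoidalCategory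
open Literature.AlgebraicTopology.SingularHomology
open Literature.AlgebraicGeometry Literature.AlgebraicGeometry.Motives
open Literature.AlgebraicGeometry.HodgeTheory

namespace Summit.HodgeConjecture.HodgeConjecture.Theorems

/-! ### STUB 1 of the line, unconditionally -/

/-- **Registered STUB 1 `stub_levelOneSpanOfCurve` of crux stmt-HodgeConjecture-10376 (line
`registered`), PROVED.** For a smooth projective threefold `Y`, a Hodge model `A` and a finite set
`s` of rational classes of `H³(Y(ℂ); ℂ)` whose span `W` is sub-Hodge and of Hodge coniveau `≥ 1`,
`W = φ(H¹(C(ℂ); ℂ))` for a smooth projective curve `C`, a Hodge model `B` of `C` and a `ℂ`-linear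
`φ` sending rational classes to rational classes and type `(p,q)` to type `(p+1,q+1)`. Riemann's
theorem in geometric form (`riemannWeightOne_proof`, the route's crux #6) through the landed
reduction `levelOneSpanOfCurve_of_riemannWeightOne` (Hodge–Riemann polarisability, smooth curve
sections injective on `H¹`, semisimplicity of polarisable Hodge structures).
[cite: KerrPearlstein2016, Ch. 11 (Abdulali) §1 p. 288] [cite: VoisinHodgeI2002, §7.2.2 and §7.3.1 Lemma 7.26] -/
theorem stub_levelOneSpanOfCurve : ∀ ⦃Y : Motives.SchemeOver ℂ⦄, Motives.IsSmoothProjective 3 Y → ∀ (A : HodgeModel 3 Y) (s : Finset (complexBetti Y 3)), (∀ c ∈ s, IsRationalClass c) → (Submodule.span ℂ (↑s : Set (complexBetti Y 3))).map (A.pullback 3).hom = (⨆ (p : ℕ) (q : ℕ) (_ : p + q = 3), (Submodule.span ℂ (↑s : Set (complexBetti Y 3))).map (A.pullback 3).hom ⊓ A.hodgePQ 3 p q) → (Submodule.span ℂ (↑s : Set (complexBetti Y 3))).map (A.pullback 3).hom ≤ (⨆ (p : ℕ) (q : ℕ) (_ : p + q = 3) (_ : 1 ≤ p) (_ : 1 ≤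 q), A.hodgePQ 3 p q) → ∃ (C : Motives.SchemeOver ℂ) (_ : Motives.IsSmoothProjective 1 C) (B : HodgeModel 1 C) (φ : complexBetti C 1 →ₗ[ℂ] complexBetti Y 3), (∀ c, IsRationalClass c → IsRationalClass (φ c)) ∧ (∀ (p q : ℕ), p + q = 1 → ∀ c, B.pullback 1 c ∈ B.hodgePQ 1 p q → A.pullback 3 (φ c) ∈ A.hodgePQ 3 (p + 1) (q + 1)) ∧ LinearMap.range φ = Submodule.span ℂ (↑s : Set (complexBetti Y 3)) :=
  fun _ hY A s hs hsub hlev ↦ levelOneSpanOfCurve_of_riemannWeightOne riemannWeightOne_proof hY A s hs hsub hlev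

/-! ### The crux is STUB 2, unconditionally -/

/-- **STUB 2 ⟹ the crux, unconditionally.** If every rational type-`(1,1)` map
`H¹(C(ℂ)) → H³(Y(ℂ))` (`C` a smooth projective curve, `Y` a smooth projective threefold) is the
action of an algebraic codimension-2 class on `Y ⊗ C`, then GHC(3,1) holds for smooth projective
threefolds — the line's composition with STUB 1 discharged.
[cite: GrothendieckTopology1969, p. 301] [cite: KerrPearlstein2016, Ch. 11 (Abdulali) Prop. 3.2 p. 291] -/
theorem levelOneConiveauThreefolds_of_curveCorrespondenceAlgebraic
    (h2 : ∀ ⦃Y C : SchemeOver ℂ⦄ (hY : IsSmoothProjective 3 Y) (hC : IsSmoothProjective 1 C)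
      (A : HodgeModel 3 Y) (B : HodgeModel 1 C) (φ : complexBetti C 1 →ₗ[ℂ] complexBetti Y 3),
      (∀ c, IsRationalClass c → IsRationalClass (φ c)) →
      (∀ (p q : ℕ), p + q = 1 → ∀ c, B.pullback 1 c ∈ B.hodgePQ 1 p q →
        A.pullback 3 (φ c) ∈ A.hodgePQ 3 (p + 1) (q + 1)) →
      ∀ (μ : OrientationFamily), ∃ γ ∈ algebraicClasses (Y ⊗ C) 2,
        corrAction μ hY hC (show 1 + 2 * 2 = 3 + 2 * 1 from rfl) γ = φ) :
    Theses.SecondaryPeriods.LevelOneConiveauThreefolds :=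
  levelOneConiveauThreefolds_of_curveCorrespondences stub_levelOneSpanOfCurve h2

/-- **The crux ⟺ STUB 2, with no hypothesis.** GHC(3,1) for smooth projective threefolds is
EQUIVALENT to the algebraicity of every level-one curve correspondence `H¹(C(ℂ)) → H³(Y(ℂ))`,
i.e. to the Hodge conjecture for the `(3,1)`-Künneth codimension-2 classes on the fourfolds
`Y × C` (previous leads: `⟸` is the line's composition, `⟹` is Deligne 8.2.8 + Hironaka +
semisimplicity + Lefschetz (1,1); STUB 1 is now `stub_levelOneSpanOfCurve`).
[cite: GrothendieckTopology1969, p. 301] [cite: KerrPearlstein2016, Ch. 11 (Abdulali) Prop. 3.2 p. 291] -/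
theorem levelOneConiveauThreefolds_iff_curveCorrespondenceAlgebraic :
    Theses.SecondaryPeriods.LevelOneConiveauThreefolds ↔
      ∀ ⦃Y C : SchemeOver ℂ⦄ (hY : IsSmoothProjective 3 Y) (hC : IsSmoothProjective 1 C)
        (A : HodgeModel 3 Y) (B : HodgeModel 1 C) (φ : complexBetti C 1 →ₗ[ℂ] complexBetti Y 3),
        (∀ c, IsRationalClass c → IsRationalClass (φ c)) →
        (∀ (p q : ℕ), p + q = 1 → ∀ c, B.pullback 1 c ∈ B.hodgePQ 1 p q →
          A.pullback 3 (φ c) ∈ A.hodgePQ 3 (p + 1) (q + 1)) →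
        ∀ (μ : OrientationFamily), ∃ γ ∈ algebraicClasses (Y ⊗ C) 2,
          corrAction μ hY hC (show 1 + 2 * 2 = 3 + 2 * 1 from rfl) γ = φ :=
  levelOneConiveauThreefolds_iff_curveCorrespondenceAlgebraic_of_levelOneSpanOfCurve
    stub_levelOneSpanOfCurve

/-- **The negative crux is witnessed by exactly one non-algebraic level-one curve correspondence**:
`ConiveauOneFailure` (stmt-HodgeConjecture-3540) holds iff some rational type-`(1,1)` map
`H¹(C(ℂ)) → H³(Y(ℂ))` is, for some orientation family, not the action of any algebraic
codimension-2 class on `Y ⊗ C`. [cite: GrothendieckTopology1969, p. 301] -/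
theorem coniveauOneFailure_iff_exists_not_curveCorrespondenceAlgebraic :
    Theses.SecondaryPeriods.ConiveauOneFailure ↔
      ∃ (Y C : SchemeOver ℂ) (hY : IsSmoothProjective 3 Y) (hC : IsSmoothProjective 1 C)
        (A : HodgeModel 3 Y) (B : HodgeModel 1 C) (φ : complexBetti C 1 →ₗ[ℂ] complexBetti Y 3),
        (∀ c, IsRationalClass c → IsRationalClass (φ c)) ∧
        (∀ (p q : ℕ), p + q = 1 → ∀ c, B.pullback 1 c ∈ B.hodgePQ 1 p q →
          A.pullback 3 (φ c) ∈ A.hodgePQ 3 (p + 1) (q + 1)) ∧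
        ∃ (μ : OrientationFamily), ¬ ∃ γ ∈ algebraicClasses (Y ⊗ C) 2,
          corrAction μ hY hC (show 1 + 2 * 2 = 3 + 2 * 1 from rfl) γ = φ := by
  unfold Theses.SecondaryPeriods.ConiveauOneFailure
  rw [levelOneConiveauThreefolds_iff_curveCorrespondenceAlgebraic]
  constructor
  · intro h
    by_contra hne
    apply h
    intro Y C hY hC A B φ hφ hφH μ
    by_contra hγ
    exact hne ⟨Y, C, hY, hC, A, B, φ, hφ, hφH, μ, hγ⟩
  · rintro ⟨Y, C, hY, hC, A, B, φ, hφ, hφH, μ, hγ⟩ h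
    exact hγ (h hY hC A B φ hφ hφH μ)

/-! ### Riemann's theorem in curve form, discharged; the pointwise equivalence at one threefold -/

/-- **Riemann's theorem on weight-one Hodge structures, CURVE form — discharged.** Every
finite-dimensional polarisable effective weight-one `ℚ`-Hodge structure is a Hodge quotient of
`H¹(C(ℂ); ℚ)` of a smooth projective CURVE `C` (the Literature named fact
`weightOne_polarizable_eq_range_of_curve`): the geometric form (`riemannWeightOne_proof`) followed
by smooth curve sections (Lefschetz hyperplane theorem on `H¹`) and semisimplicity
(`weightOne_polarizable_eq_range_of_curve_of_geometric`).
[cite: KerrPearlstein2016, Ch. 11 (Abdulali) §1 p. 288] [cite: VoisinHodgeI2002, §7.2.2 and §7.3.1 Lemma 7.26]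
[cite: VoisinHodgeII2003, §1.2.2 Thm. 1.23] -/
theorem weightOne_polarizable_eq_range_of_curve_holds : weightOne_polarizable_eq_range_of_curve :=
  weightOne_polarizable_eq_range_of_curve_of_geometric riemannWeightOne_proof

/-- **GHC(3,1) at ONE threefold from the algebraicity of the level-one curve correspondences into
ITS `H³`** (pointwise form of the line, unconditional): for `Y` smooth projective of dimension `3`
and a Hodge model `A`, if every rational type-`(1,1)` map `H¹(C(ℂ)) → H³(Y(ℂ))` from a smooth
projective curve is the action (for the orientation family `μ`) of an algebraic codimension-2
class on `Y ⊗ C`, then every rationally spanned level-one sub-Hodge structure of `H³(Y(ℂ); ℂ)`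
lies in `N¹H³(Y)`. [cite: GrothendieckTopology1969, p. 301] [cite: KerrPearlstein2016, Ch. 11 (Abdulali) Prop. 3.2 p. 291] -/
theorem levelOneConiveauAt_of_curveCorrespondenceAlgebraicAt (μ : OrientationFamily)
    {Y : SchemeOver ℂ} (hY : IsSmoothProjective 3 Y) (A : HodgeModel 3 Y)
    (h2 : ∀ ⦃C : SchemeOver ℂ⦄ (hC : IsSmoothProjective 1 C) (B : HodgeModel 1 C)
      (φ : complexBetti C 1 →ₗ[ℂ] complexBetti Y 3),
      (∀ c, IsRationalClass c → IsRationalClass (φ c)) →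
      (∀ (p q : ℕ), p + q = 1 → ∀ c, B.pullback 1 c ∈ B.hodgePQ 1 p q →
        A.pullback 3 (φ c) ∈ A.hodgePQ 3 (p + 1) (q + 1)) →
      ∃ γ ∈ algebraicClasses (Y ⊗ C) 2,
        corrAction μ hY hC (show 1 + 2 * 2 = 3 + 2 * 1 from rfl) γ = φ)
    (s : Finset (complexBetti Y 3)) (hs : ∀ c ∈ s, IsRationalClass c)
    (hsub : (Submodule.span ℂ (↑s : Set (complexBetti Y 3))).map (A.pullback 3).hom =
      ⨆ (p : ℕ) (q : ℕ) (_ : p + q = 3),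
        (Submodule.span ℂ (↑s : Set (complexBetti Y 3))).map (A.pullback 3).hom ⊓ A.hodgePQ 3 p q)
    (hlev : (Submodule.span ℂ (↑s : Set (complexBetti Y 3))).map (A.pullback 3).hom ≤
      ⨆ (p : ℕ) (q : ℕ) (_ : p + q = 3) (_ : 1 ≤ p) (_ : 1 ≤ q), A.hodgePQ 3 p q) :
    Submodule.span ℂ (↑s : Set (complexBetti Y 3)) ≤ supportedClasses Y 3 1 :=
  span_le_supportedClasses_of_curveRealisation μ hY A _ (stub_levelOneSpanOfCurve hY A s hs hsub hlev)
    h2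

/-- **Pointwise equivalence at one threefold** (unconditional): for `Y` smooth projective of
dimension `3` and a Hodge model `A`, GHC(3,1) for the rationally spanned level-one sub-Hodge
structures of `H³(Y(ℂ); ℂ)` holds iff every rational type-`(1,1)` map `H¹(C(ℂ)) → H³(Y(ℂ))` from a
smooth projective curve is, for every orientation family, the action of an algebraic
codimension-2 class on `Y ⊗ C` — "GHC(3,1) at `Y`" is "HC for the `(3,1)`-Künneth codimension-2
classes on the fourfolds `Y × C`". [cite: GrothendieckTopology1969, p. 301] [cite: KerrPearlstein2016, Ch. 11 (Abdulali) Prop. 3.2 p. 291] -/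
theorem levelOneConiveauAt_iff_curveCorrespondenceAlgebraicAt {Y : SchemeOver ℂ}
    (hY : IsSmoothProjective 3 Y) (A : HodgeModel 3 Y) :
    (∀ (s : Finset (complexBetti Y 3)), (∀ c ∈ s, IsRationalClass c) →
      (Submodule.span ℂ (↑s : Set (complexBetti Y 3))).map (A.pullback 3).hom =
        (⨆ (p : ℕ) (q : ℕ) (_ : p + q = 3),
          (Submodule.span ℂ (↑s : Set (complexBetti Y 3))).map (A.pullback 3).hom ⊓
            A.hodgePQ 3 p q) →
      (Submodule.span ℂ (↑s : Set (complexBetti Y 3))).map (A.pullback 3).hom ≤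
        (⨆ (p : ℕ) (q : ℕ) (_ : p + q = 3) (_ : 1 ≤ p) (_ : 1 ≤ q), A.hodgePQ 3 p q) →
      Submodule.span ℂ (↑s : Set (complexBetti Y 3)) ≤ supportedClasses Y 3 1) ↔
    ∀ ⦃C : SchemeOver ℂ⦄ (hC : IsSmoothProjective 1 C) (B : HodgeModel 1 C)
      (φ : complexBetti C 1 →ₗ[ℂ] complexBetti Y 3),
      (∀ c, IsRationalClass c → IsRationalClass (φ c)) →
      (∀ (p q : ℕ), p + q = 1 → ∀ c, B.pullback 1 c ∈ B.hodgePQ 1 p q →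
        A.pullback 3 (φ c) ∈ A.hodgePQ 3 (p + 1) (q + 1)) →
      ∀ (μ : OrientationFamily), ∃ γ ∈ algebraicClasses (Y ⊗ C) 2,
        corrAction μ hY hC (show 1 + 2 * 2 = 3 + 2 * 1 from rfl) γ = φ := by
  refine ⟨fun h C hC B φ hφ hφH μ ↦
    curveCorrespondenceAlgebraic_of_levelOneConiveauAt hY hC A h B φ hφ hφH μ, fun h s hs hsub hlev ↦ ?_⟩
  -- an orientation family (the complex points of a smooth projective variety are orientable)
  obtain ⟨μ⟩ : Nonempty OrientationFamily :=
    ⟨fun _ _ h ↦ Classical.choice (Motives.ComplexPoints.isOrientableOver ℂ h)⟩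
  exact levelOneConiveauAt_of_curveCorrespondenceAlgebraicAt μ hY A
    (fun C hC B φ hφ hφH ↦ h hC B φ hφ hφH μ) s hs hsub hlev

/-- **GHC(3,1) at ONE threefold from the codimension-2 Hodge conjecture on ITS products with
curves** (unconditional; Grothendieck's observation pointwise): if for every smooth projective
curve `C` every rational `(2,2)`-class on the fourfold `Y ⊗ C` is algebraic, then every rationally
spanned level-one sub-Hodge structure of `H³(Y(ℂ); ℂ)` lies in `N¹H³(Y)`.
[cite: GrothendieckTopology1969, p. 301] [cite: VoisinHodgeI2002, Lemma 11.41] -/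
theorem levelOneConiveauAt_of_hodgeConjectureFor_prod_curve {Y : SchemeOver ℂ}
    (hY : IsSmoothProjective 3 Y)
    (hHC : ∀ ⦃C : SchemeOver ℂ⦄, IsSmoothProjective 1 C → ∀ γ : complexBetti (Y ⊗ C) (2 * 2),
      IsRationalClass γ → IsOfHodgeType (3 + 1) (Y ⊗ C) (2 * 2) 2 2 γ → γ ∈ algebraicClasses (Y ⊗ C) 2)
    (A : HodgeModel 3 Y) (s : Finset (complexBetti Y 3)) (hs : ∀ c ∈ s, IsRationalClass c)
    (hsub : (Submodule.span ℂ (↑s : Set (complexBetti Y 3))).map (A.pullback 3).hom =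
      ⨆ (p : ℕ) (q : ℕ) (_ : p + q = 3),
        (Submodule.span ℂ (↑s : Set (complexBetti Y 3))).map (A.pullback 3).hom ⊓ A.hodgePQ 3 p q)
    (hlev : (Submodule.span ℂ (↑s : Set (complexBetti Y 3))).map (A.pullback 3).hom ≤
      ⨆ (p : ℕ) (q : ℕ) (_ : p + q = 3) (_ : 1 ≤ p) (_ : 1 ≤ q), A.hodgePQ 3 p q) :
    Submodule.span ℂ (↑s : Set (complexBetti Y 3)) ≤ supportedClasses Y 3 1 :=
  span_le_supportedClasses_of_weightOne_curve_of_hodgeConjectureFor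
    weightOne_polarizable_eq_range_of_curve_holds hY hHC A s hs hsub hlev

/-! ### Grothendieck's observation HC ⟹ GHC(3,1), unconditionally -/

/-- **The crux from the Hodge conjecture, unconditionally**: HC on the fourfolds `Y ⊗ C` makes
every level-one curve correspondence algebraic (Voisin I Lemma 11.41,
`curveCorrespondenceAlgebraic_of_hodgeConjecture`), and STUB 2 gives the crux.
[cite: GrothendieckTopology1969, p. 301] [cite: VoisinHodgeI2002, Lemma 11.41] -/
theorem levelOneConiveauThreefolds_of_hodgeConjecture (hHC : _root_.HodgeConjecture) :
    Theses.SecondaryPeriods.LevelOneConiveauThreefolds :=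
  levelOneConiveauThreefolds_of_curveCorrespondenceAlgebraic
    (fun _ _ hY hC A B φ hφ hφH μ ↦ curveCorrespondenceAlgebraic_of_hodgeConjecture hHC hY hC A B φ hφ hφH μ)

/-- **Support item `HodgeImpliesConiveauOne` (stmt-HodgeConjecture-3541) of route `SecondaryPeriods`,
PROVED unconditionally**: `HodgeConjecture → LevelOneConiveauThreefolds` (Grothendieck 1969:
Riemann + HC on `Y × C` + Gysin support calculus; the Riemann input is `riemannWeightOne_proof`).
[cite: GrothendieckTopology1969, p. 301] [cite: KerrPearlstein2016, Ch. 11 (Abdulali) Prop. 3.2 p. 291] -/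
theorem hodgeImpliesConiveauOne_proof : Theses.SecondaryPeriods.HodgeImpliesConiveauOne :=
  fun hHC ↦ levelOneConiveauThreefolds_of_hodgeConjecture hHC

/-! ### v2 (c3): the carrier-level curve fact of the story, discharged -/

/-- **`levelOne_subHodge_eq_range_of_curve` — discharged.** The Literature named fact of the story
`HodgeTheory/LevelOneSubHodgeStructuresOfCurves` (a rationally spanned sub-Hodge structure
`W ⊆ H^{2s+1}(Y(ℂ); ℂ)` of Hodge coniveau `≥ s` of a smooth projective `Y` is the image of
`H¹(C(ℂ); ℂ)`, `C` a smooth projective CURVE, under a rational map of type `(s, s)`) follows from its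
two printed inputs, both now theorems: Riemann's theorem in curve form
(`weightOne_polarizable_eq_range_of_curve_holds`, above) and Hodge–Riemann polarisability
(`smoothProjective_hodgeStructure_isPolarizable_holds`), by the landed reduction
`levelOne_subHodge_eq_range_of_curve_holds_of`.
[cite: KerrPearlstein2016, Ch. 11 (Abdulali) §1 p. 288] [cite: VoisinHodgeI2002, §7.2.2 and §7.3.1 Lemma 7.26] -/
theorem levelOne_subHodge_eq_range_of_curve_holds : levelOne_subHodge_eq_range_of_curve :=
  levelOne_subHodge_eq_range_of_curve_holds_of weightOne_polarizable_eq_range_of_curve_holds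
    smoothProjective_hodgeStructure_isPolarizable_holds

end Summit.HodgeConjecture.HodgeConjecture.Theorems

end
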